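import Summits.QuantumFields.YangMills.Theorems.BalabanUVNodesN07QOfRecordGaugeCovariance
import Summits.QuantumFields.YangMills.Theorems.BalabanUVNodesK0Stub1FlatAveragingDictionary
import Literature.MathematicalPhysics.QuantumFieldTheory.Balaban1983to89.Node00.LinearisedAveragingInfinitesimalGauge
import Literature.MathematicalPhysics.QuantumFieldTheory.Balaban1983to89.Node00.BgGaugeLetterOfRecord
import HarnessLib

/-!
# NODE N07 — (g2) AT A GENERAL GUARDED BACKGROUND: def-Y's PINNED `Q(U₀) = QOfRecord F N k U₀` MAPS THE INFINITESIMAL GAUGE VARIATION `D(U₀)λ` TO THE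
# COARSE COVARIANT DIFFERENTIAL OF `λ∘emb^k` AT `Ū^k(U₀)` — `Q(U₀)(D(U₀)λ) = η_k⁻¹L^{-k}·D♭_{Ū^k(U₀)}(λ∘emb^k)` — HENCE `Q′♭λ = 0 ⟹ Q(U₀)(D(U₀)λ) = 0`

Cell `pub-ymgap`, width seat `pub-ymgap-dag-n07-w3` (g25), INTENT-3 ∕ CLAIM-3.  `--kind proof --supports stmt-QuantumFields-27238 --as helper`; count-neutral.
[B9] = [Balaban1985BackgroundPropagators]; [15] = [Balaban1985Variational]; [B7] = [Balaban1985Averaging]; [B5] = [Balaban1984PropagatorsI].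

WHY.  The (3.124) identities `Q𝔊 = 0`, `RD*𝔊 = 0` ([15] p. 294, (102)∕(111)) for def-Y's handles need hypothesis (g2) «`Q′♭λ = 0 → Q(U₀)(D(U₀)λ) = 0`» (lit
✓`B9Eq3119InvariantExtension.h124_of_printExtension` for the Δ_π sibling pin; ✓`frakGLatticeCLM_mem_constraint102_of_gaugeModes` for the bare pin).  The tree had (g2)
ONLY at `U₀ = 1` (g24 ✓`QOfRecord_one_covDerivL2K_eq_zero`) and on the flat orbit (✓`QOfRecord_pureGauge_covDerivL2K_eq_zero`); RR-2 g29's CHECK-Δ word (R-Δ3) names the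
general-background statement «the derivative of `T4Continuum.iter_gaugeAct`, an n07 target».  Its engine IS in the tree: n07-w1 g5's ✓`Node00.dIterL_apply_infGauge` — under
35b's guard, `Q_k(↑U₀)[b ↦ λ(b₋)U₀(b) − U₀(b)λ(b₊)](c) = λ(emb^k c₋)Ū^k(U₀)(c) − Ū^k(U₀)(c)λ(emb^k c₊)` for `𝔰𝔲(N)`-valued `λ` ([B7] (11) «`Ū^u = (Ū)^ū`» to first order).
This file carries it to def-Y's pinned complexified letter `QOfRecord` (left chart, right trivialisation, `L^{-k}`, `cplxOp`) and to the lit carriers: the `𝔲(N)` phase line by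
n07's ✓`dIterL_phase_eq_flat_mul` + k0-s1-w1's ✓`dIterL_one_grad`, the split by n07-e's ✓`sub_phase_mem_lieSU`, the complexification by def-Y's `cplxOp_apply`∕`skewField_decomp`
(g24's ✓`qCplxOp_one_grad` pattern, now at `U₀`).

WHAT IS PROVED (sorry-free; no definition; axioms standard).
* §1 (matrix level, any `P`, guard `SmallBelow (fun j => blockAvg expMeanLogSU) k U₀`): `covGradM_apply_*` bookkeeping, `skewField_covGradM` ∕ `skewField_negI_covGradM` (𝔞 commutes
  with `λ ↦ (b ↦ U₀(b)λ(b₊)U₀(b)⋆ − λ(b₋))`), `dIterL_one_phase_grad` (the flat phase line of a pure gauge), ★★ `dIterL_apply_infGauge_skew` (n07-w1's row extended from `𝔰𝔲(N)` to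
  ALL skew-Hermitian `χ`: `Q_k(↑U₀)[b ↦ χ(b₋)U₀(b) − U₀(b)χ(b₊)](c) = χ(emb^k c₋)Ū(c) − Ū(c)χ(emb^k c₊)`), ★★ `qSkewOp_covGradM` (def-Y's real-form letter:
  `qSkewOp k U₀ (b ↦ U₀χ(b₊)U₀⋆ − χ(b₋)) c = L^{-k} • (Ū(c)χ(emb^k c₊)Ū(c)⋆ − χ(emb^k c₋))`), ★★ `qCplxOp_covGradM` (the same for the complexified letter and EVERY matrix field `λ`).
* §2 (the record): `bondFieldIn_covDerivL2K` (the read-in of `D(U₀)l` is `cRec • (b ↦ U₀λ(b₊)U₀⋆ − λ(b₋))`, `λ = siteFieldIn l`), ★★★ `QOfRecord_covDerivL2K`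
  (`SmallBelow (avOfRecord F N K) k U₀ → QOfRecord F N k U₀ (covDerivL2K … (RRec F N U₀) l) = (WL2.equiv …).symm (c ↦ φ⁻¹((cRec·L^{-k}) • (Ū(c)λ(emb^k c₊)Ū(c)⋆ − λ(emb^k c₋))))`,
  `Ū = Averaging.iter (avOfRecord F N K) k U₀`), ★★★ `QOfRecord_covDerivL2K_eq_zero_of_QflatOfRecord_eq_zero` — **(g2) AT EVERY GUARDED BACKGROUND**:
  `QflatOfRecord F N k l = 0 → QOfRecord F N k U₀ (covDerivL2K … (RRec F N U₀) l) = 0`.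

HONEST SCOPE.  Calculus ∕ algebra at the tree's own averaging map — one chain rule (n07-w1's engine, by name) plus bookkeeping; no estimate of the series; (g1) for the
bare Hessian `hessOpOfRecord U₀` at a general `U₀` is NOT touched (false-shaped off the flat orbit, error ∝ `J(U₀)` — [B9] (3.117)); the guard `SmallBelow` is 35b's
differentiability locus (every member of the small-field class), displayed; `hpos` at small field OPEN; P0 ⟨26900⟩ OPEN; K0ᴬ∕K1ᴬ∕K3ᴬ OPEN; N07 NOT discharged;
COUNT 8∕28 · K 1∕4 UNMOVED; finite `𝕋⁴` at fixed `ε` — R4 closes only the conditional finite-𝕋⁴ rung `BalabanLadder.UV`, never the summit; nothing continuum ∕ ℝ⁴ ∕ OS;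
the Yang–Mills mass gap (Clay) is NOT proved by any of this.  No `sorry`, no `def`, no `instance`, no `notation`.

References: [B9] (3.1)–(3.3) pp. 390–391, (3.13)–(3.16) p. 393, (3.29) p. 395, (3.117) p. 419, (3.124) p. 420; [15] (3)–(5) p. 278, (44) p. 285, (82)–(83) p. 290, (102) p. 293,
(110)–(111) p. 294; [B7] (8), (11) pp. 18–19; [B5] (1.55) p. 27.
-/

set_option autoImplicit false

noncomputable section

open scoped Matrix InnerProductSpace ComplexConjugate

namespace Summit.QuantumFields.YangMills.Theorems.N07QOfRecordInfGauge

open Literature.MathematicalPhysics.QuantumFieldTheory.Balaban1983to89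
open Literature.MathematicalPhysics.QuantumFieldTheory.Balaban1983to89.T4Continuum (T4Family)
open T4Continuum BlockAveraging B15DeterminingSets
open ExpMeanLog (expMeanLogSU)
open B9Eq311L2Pairing (WL2)
open B9SectCLatticeCarrier (Bond bpos btgt)
open B11Eq103H1Complex (SiteL2K BondL2K covDerivL2K equiv_covDerivL2K)
open B9Eq33CovDerivVector (covDeriv_apply)
open T4AdjointCovarianceUnitary (lieSU mem_lieSU_iff specialUnitaryAd coe_specialUnitaryAd)
open Node00
open Summit.QuantumFields.YangMills.Theorems.N07QOfRecordFlatOnto (skewField_conjTranspose)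
open Summit.QuantumFields.YangMills.BalabanUVNodes.N07AveragingPhaseEquivariance (dIterL_phase_eq_flat_mul)
open Summit.QuantumFields.YangMills.Theorems.K0Stub1FlatAveragingDictionary (dIterL_one_grad)
open Summit.QuantumFields.YangMills.BalabanUVNodes.N07QOfRecordOntoSmallField (sub_phase_mem_lieSU)

variable {P : Params} {N : ℕ}

/-! ## §1  Matrix level: `Q_k(U₀)` of the left-chart covariant differential `b ↦ U₀(b)λ(b₊)U₀(b)⋆ − λ(b₋)` -/

/-- The skew part commutes with the background-covariant differential: `𝔞(U₀λ(b₊)U₀⋆ − λ(b₋)) = U₀(𝔞λ)(b₊)U₀⋆ − (𝔞λ)(b₋)`.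
[cite: Balaban1985BackgroundPropagators, (3.3) p.391, p.393 (bookkeeping)] -/
theorem skewField_covGradM (U₀ : GaugeField P 0 (SU N)) (lam : Site P 0 → Matrix (Fin N) (Fin N) ℂ) :
    skewField (fun b : PBond P 0 => (U₀ b : Matrix (Fin N) (Fin N) ℂ) * lam b.tgt * star (U₀ b : Matrix (Fin N) (Fin N) ℂ) - lam b.src) =
      fun b : PBond P 0 => (U₀ b : Matrix (Fin N) (Fin N) ℂ) * skewField lam b.tgt * star (U₀ b : Matrix (Fin N) (Fin N) ℂ) - skewField lam b.src := by
  funext b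
  simp only [skewField_apply, Matrix.conjTranspose_sub, Matrix.conjTranspose_mul, Matrix.conjTranspose_conjTranspose, Matrix.star_eq_conjTranspose,
    smul_sub, mul_sub, sub_mul, mul_smul_comm, smul_mul_assoc, mul_assoc]
  abel

/-- The same for the rotated field `−iλ`: `𝔞(−i·(U₀λ(b₊)U₀⋆ − λ(b₋))) = U₀(𝔞(−iλ))(b₊)U₀⋆ − (𝔞(−iλ))(b₋)`. [cite: Balaban1985BackgroundPropagators, p.393 (bookkeeping)] -/
theorem skewField_negI_covGradM (U₀ : GaugeField P 0 (SU N)) (lam : Site P 0 → Matrix (Fin N) (Fin N) ℂ) :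
    skewField (-Complex.I • fun b : PBond P 0 => (U₀ b : Matrix (Fin N) (Fin N) ℂ) * lam b.tgt * star (U₀ b : Matrix (Fin N) (Fin N) ℂ) - lam b.src) =
      fun b : PBond P 0 => (U₀ b : Matrix (Fin N) (Fin N) ℂ) * skewField (-Complex.I • lam) b.tgt * star (U₀ b : Matrix (Fin N) (Fin N) ℂ) -
        skewField (-Complex.I • lam) b.src := by
  have h : (-Complex.I • fun b : PBond P 0 => (U₀ b : Matrix (Fin N) (Fin N) ℂ) * lam b.tgt * star (U₀ b : Matrix (Fin N) (Fin N) ℂ) - lam b.src) =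
      fun b : PBond P 0 => (U₀ b : Matrix (Fin N) (Fin N) ℂ) * (-Complex.I • lam) b.tgt * star (U₀ b : Matrix (Fin N) (Fin N) ℂ) - (-Complex.I • lam) b.src := by
    funext b
    simp only [Pi.smul_apply, smul_sub, mul_smul_comm, smul_mul_assoc]
  rw [h]
  exact skewField_covGradM U₀ (-Complex.I • lam)

variable [NeZero N]

/-- **THE FLAT PHASE LINE OF A PURE GAUGE**: for a real site function `θ`, `Q_k(1)[b ↦ (i(θ(b₋) − θ(b₊)))·1](c) = (i(θ(emb^k c₋) − θ(emb^k c₊)))·1` (k0-s1-w1's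
✓`dIterL_one_grad` on the skew field `x ↦ −(iθ(x))·1`). [cite: Balaban1985Averaging, (11) p.19; Balaban1985Variational, (44) p.285] -/
theorem dIterL_one_phase_grad (θ : Site P 0 → ℝ) (k : ℕ) (c : PBond P k) :
    dIterL k (1 : PBond P 0 → Matrix (Fin N) (Fin N) ℂ)
        (fun b : PBond P 0 => ((((θ b.src - θ b.tgt : ℝ) : ℂ) * Complex.I)) • (1 : Matrix (Fin N) (Fin N) ℂ)) c =
      ((((θ (embIter k c.src) - θ (embIter k c.tgt) : ℝ) : ℂ) * Complex.I)) • (1 : Matrix (Fin N) (Fin N) ℂ) := by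
  set φ : Site P 0 → Matrix (Fin N) (Fin N) ℂ := fun x => -(((((θ x : ℝ) : ℂ) * Complex.I)) • (1 : Matrix (Fin N) (Fin N) ℂ)) with hφ
  have hφskew : ∀ x, star (φ x) = -φ x := fun x => by
    simp only [hφ, star_neg, star_smul, star_one, Complex.star_def, map_mul, Complex.conj_ofReal, Complex.conj_I, mul_neg, neg_smul, neg_neg]
  have hdir : (fun b : PBond P 0 => ((((θ b.src - θ b.tgt : ℝ) : ℂ) * Complex.I)) • (1 : Matrix (Fin N) (Fin N) ℂ)) = fun b : PBond P 0 => φ b.tgt - φ b.src := by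
    funext b
    simp only [hφ, Complex.ofReal_sub, sub_mul, sub_smul]
    abel
  rw [hdir, dIterL_one_grad hφskew k c]
  simp only [hφ, Complex.ofReal_sub, sub_mul, sub_smul]
  abel

/-- ★★ **n07-w1's ROW FOR EVERY SKEW-HERMITIAN `χ`** (`𝔲(N) = 𝔰𝔲(N) ⊕ iℝ·1`): under 35b's guard below `k`,
`Q_k(↑U₀)[b ↦ χ(b₋)U₀(b) − U₀(b)χ(b₊)](c) = χ(emb^k c₋)Ū^k(U₀)(c) − Ū^k(U₀)(c)χ(emb^k c₊)` — the traceless part by ✓`dIterL_apply_infGauge`, the phase line by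
✓`dIterL_phase_eq_flat_mul` + `dIterL_one_phase_grad` (central, so it commutes past `Ū`). [cite: Balaban1985Averaging, (11) p.19; Balaban1985Variational, (44) p.285] -/
theorem dIterL_apply_infGauge_skew {U₀ : GaugeField P 0 (SU N)} {k : ℕ} (h : SmallBelow (fun j => blockAvg (P := P) (j := j) expMeanLogSU) k U₀)
    {χ : Site P 0 → Matrix (Fin N) (Fin N) ℂ} (hχ : ∀ x, star (χ x) = -χ x) (c : PBond P k) :
    dIterL k (coeField U₀) (fun b : PBond P 0 => χ b.src * (U₀ b : Matrix (Fin N) (Fin N) ℂ) - (U₀ b : Matrix (Fin N) (Fin N) ℂ) * χ b.tgt) c =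
      χ (embIter k c.src) * ((Averaging.iter (fun j => blockAvg (P := P) (j := j) expMeanLogSU) k U₀ c : SU N) : Matrix (Fin N) (Fin N) ℂ) -
        ((Averaging.iter (fun j => blockAvg (P := P) (j := j) expMeanLogSU) k U₀ c : SU N) : Matrix (Fin N) (Fin N) ℂ) * χ (embIter k c.tgt) := by
  -- split `χ = χ₀ + (iθ)·1`
  set θ : Site P 0 → ℝ := fun x => (Matrix.trace (χ x)).im / N with hθ
  set L : Site P 0 → lieSU (Fin N) := fun x => ⟨χ x - ((((θ x : ℝ) : ℂ) * Complex.I)) • (1 : Matrix (Fin N) (Fin N) ℂ), sub_phase_mem_lieSU (hχ x)⟩ with hL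
  have hsplit : ∀ x, χ x = (L x : Matrix (Fin N) (Fin N) ℂ) + ((((θ x : ℝ) : ℂ) * Complex.I)) • (1 : Matrix (Fin N) (Fin N) ℂ) := fun x => by
    simp [hL]
  have hdir : (fun b : PBond P 0 => χ b.src * (U₀ b : Matrix (Fin N) (Fin N) ℂ) - (U₀ b : Matrix (Fin N) (Fin N) ℂ) * χ b.tgt) =
      (fun b : PBond P 0 => (L b.src : Matrix (Fin N) (Fin N) ℂ) * (U₀ b : Matrix (Fin N) (Fin N) ℂ) - (U₀ b : Matrix (Fin N) (Fin N) ℂ) * (L b.tgt : Matrix (Fin N) (Fin N) ℂ)) +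
        fun b : PBond P 0 => ((((θ b.src - θ b.tgt : ℝ) : ℂ) * Complex.I)) • (U₀ b : Matrix (Fin N) (Fin N) ℂ) := by
    funext b
    rw [Pi.add_apply, hsplit b.src, hsplit b.tgt]
    simp only [add_mul, mul_add, smul_mul_assoc, one_mul, mul_smul_comm, mul_one, Complex.ofReal_sub, sub_mul, sub_smul]
    abel
  rw [hdir, map_add, Pi.add_apply, dIterL_apply_infGauge h L c]
  have hph := congrFun (dIterL_phase_eq_flat_mul h (fun b : PBond P 0 => θ b.src - θ b.tgt)) c
  rw [hph, dIterL_one_phase_grad θ k c, hsplit (embIter k c.src), hsplit (embIter k c.tgt)]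
  simp only [add_mul, mul_add, smul_mul_assoc, one_mul, mul_smul_comm, mul_one, Complex.ofReal_sub, sub_mul, sub_smul]
  abel

/-- ★★ **def-Y's REAL-FORM LETTER ON THE COVARIANT DIFFERENTIAL**: under 35b's guard below `k`, for skew-Hermitian `χ`,
`qSkewOp k U₀ (b ↦ U₀(b)χ(b₊)U₀(b)⋆ − χ(b₋)) c = L^{-k} • (Ū^k(U₀)(c)·χ(emb^k c₊)·Ū^k(U₀)(c)⋆ − χ(emb^k c₋))` — the left-chart direction `X·U₀ = U₀χ(b₊) − χ(b₋)U₀` is MINUS the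
infinitesimal gauge direction, and the right trivialisation at `Ū^k(U₀)` turns n07-w1's row into the coarse covariant differential.
[cite: Balaban1985BackgroundPropagators, (3.13)–(3.15) p.393, (3.3) p.391; Balaban1985Variational, (44) p.285; Balaban1985Averaging, (11) p.19] -/
theorem qSkewOp_covGradM {U₀ : GaugeField P 0 (SU N)} {k : ℕ} (h : SmallBelow (fun j => blockAvg (P := P) (j := j) expMeanLogSU) k U₀)
    {χ : Site P 0 → Matrix (Fin N) (Fin N) ℂ} (hχ : ∀ x, star (χ x) = -χ x) (c : PBond P k) :
    qSkewOp k U₀ (fun b : PBond P 0 => (U₀ b : Matrix (Fin N) (Fin N) ℂ) * χ b.tgt * star (U₀ b : Matrix (Fin N) (Fin N) ℂ) - χ b.src) c =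
      ((P.L : ℂ) ^ k)⁻¹ • (((Averaging.iter (fun j => blockAvg (P := P) (j := j) expMeanLogSU) k U₀ c : SU N) : Matrix (Fin N) (Fin N) ℂ) * χ (embIter k c.tgt) *
          star ((Averaging.iter (fun j => blockAvg (P := P) (j := j) expMeanLogSU) k U₀ c : SU N) : Matrix (Fin N) (Fin N) ℂ) - χ (embIter k c.src)) := by
  have hdir : (fun b : PBond P 0 => ((U₀ b : Matrix (Fin N) (Fin N) ℂ) * χ b.tgt * star (U₀ b : Matrix (Fin N) (Fin N) ℂ) - χ b.src) * (U₀ b : Matrix (Fin N) (Fin N) ℂ)) =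
      -fun b : PBond P 0 => χ b.src * (U₀ b : Matrix (Fin N) (Fin N) ℂ) - (U₀ b : Matrix (Fin N) (Fin N) ℂ) * χ b.tgt := by
    funext b
    rw [Pi.neg_apply, sub_mul, mul_assoc, mul_assoc, star_coe_mul_coe_SU, mul_one, neg_sub]
  rw [qSkewOp_apply, hdir, map_neg, Pi.neg_apply, dIterL_apply_infGauge_skew h hχ c, ← coeField_iter_eq_iterM k h, coeField_apply]
  congr 1
  set V : Matrix (Fin N) (Fin N) ℂ := ((Averaging.iter (fun j => blockAvg (P := P) (j := j) expMeanLogSU) k U₀ c : SU N) : Matrix (Fin N) (Fin N) ℂ)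
  have hV : V * star V = 1 := coe_mul_star_coe_SU _
  rw [neg_mul, sub_mul, mul_assoc (χ (embIter k c.src)), hV, mul_one, neg_sub]

/-- ★★ **def-Y's COMPLEXIFIED LETTER `qCplxOp k U₀` ON THE COVARIANT DIFFERENTIAL OF EVERY MATRIX FIELD `λ`**: under 35b's guard below `k`,
`qCplxOp k U₀ (b ↦ U₀λ(b₊)U₀⋆ − λ(b₋)) c = L^{-k} • (Ū(c)λ(emb^k c₊)Ū(c)⋆ − λ(emb^k c₋))` (the two skew parts by `qSkewOp_covGradM`, recombined by `skewField_decomp`).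
[cite: Balaban1985BackgroundPropagators, (3.13)–(3.16) p.393, p.393 («extend … to 𝔤ᶜ»); Balaban1985Variational, (44) p.285] -/
theorem qCplxOp_covGradM {U₀ : GaugeField P 0 (SU N)} {k : ℕ} (h : SmallBelow (fun j => blockAvg (P := P) (j := j) expMeanLogSU) k U₀)
    (lam : Site P 0 → Matrix (Fin N) (Fin N) ℂ) (c : PBond P k) :
    qCplxOp k U₀ (fun b : PBond P 0 => (U₀ b : Matrix (Fin N) (Fin N) ℂ) * lam b.tgt * star (U₀ b : Matrix (Fin N) (Fin N) ℂ) - lam b.src) c =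
      ((P.L : ℂ) ^ k)⁻¹ • (((Averaging.iter (fun j => blockAvg (P := P) (j := j) expMeanLogSU) k U₀ c : SU N) : Matrix (Fin N) (Fin N) ℂ) * lam (embIter k c.tgt) *
          star ((Averaging.iter (fun j => blockAvg (P := P) (j := j) expMeanLogSU) k U₀ c : SU N) : Matrix (Fin N) (Fin N) ℂ) - lam (embIter k c.src)) := by
  have hs1 : ∀ x, star (skewField lam x) = -skewField lam x := fun x => by rw [Matrix.star_eq_conjTranspose]; exact skewField_conjTranspose lam x
  have hs2 : ∀ x, star (skewField (-Complex.I • lam) x) = -skewField (-Complex.I • lam) x := fun x => by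
    rw [Matrix.star_eq_conjTranspose]; exact skewField_conjTranspose (-Complex.I • lam) x
  unfold qCplxOp
  rw [cplxOp_apply, skewField_covGradM, skewField_negI_covGradM, Pi.add_apply, Pi.smul_apply, qSkewOp_covGradM h hs1 c, qSkewOp_covGradM h hs2 c]
  have ht := congrFun (skewField_decomp lam) (embIter k c.tgt)
  have hsrc := congrFun (skewField_decomp lam) (embIter k c.src)
  simp only [Pi.add_apply, Pi.smul_apply] at ht hsrc
  rw [← ht, ← hsrc]
  simp only [smul_sub, mul_add, add_mul, mul_smul_comm, smul_mul_assoc, smul_add]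
  module

/-! ## §2  At the record, in def-Y's slot types: `Q(U₀)(D(U₀) l)` and (g2) at every guarded background -/

section Record

variable (F : T4Family) {K : ℕ} (k : ℕ) (U₀ : GaugeField (F.P K) 0 (SU N))

omit [NeZero N] in
/-- **THE READ-IN OF `D(U₀) l` IS `η_k⁻¹` TIMES THE LEFT-CHART COVARIANT DIFFERENTIAL of the read-in site function** (`RRec F N U₀ a = Ad_{U₀(a)}` on the fibre, [B9] (3.3)).
[cite: Balaban1985BackgroundPropagators, (3.3) pp.390–391] -/
theorem bondFieldIn_covDerivL2K [Fact (0 < c0Rec F K k)] (l : SiteL2K ℂ (F.P K).d (fun _ => (F.P K).sitesPerDir 0) (c0Rec F K k) (WRec N)) :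
    bondFieldIn F N k (covDerivL2K ℂ (c0Rec F K k) (cRec F K k) (RRec F N U₀) l) =
      fun b : PBond (F.P K) 0 => cRec F K k • ((U₀ b : Matrix (Fin N) (Fin N) ℂ) * siteFieldIn F N k l b.tgt * star (U₀ b : Matrix (Fin N) (Fin N) ℂ) -
        siteFieldIn F N k l b.src) := by
  funext b
  rw [bondFieldIn_apply, equiv_covDerivL2K, covDeriv_apply, RRec_apply, btgt_bondToLit, bpos_bondToLit, map_smul, map_sub, LinearEquiv.apply_symm_apply,
    coe_unitsOfRecord, coe_unitsOfRecord_inv, Equiv.symm_apply_apply, siteFieldIn_apply, siteFieldIn_apply]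

/-- ★★★ **`Q(U₀)(D(U₀) l) = η_k⁻¹L^{-k}·D♭_{Ū^k(U₀)}(l∘emb^k)` FOR def-Y's PINNED LETTERS AT EVERY GUARDED BACKGROUND** — the general-background form of g24's flat
✓`QOfRecord_one_covDerivL2K` ([B5] (1.55)-shape «Q_k∂ = ∂₁Q′_k» for the (0.4)-linearised `Q(U₀)` and the centre-restriction site letter, now covariant: the coarse differential is
`c ↦ Ū(c)·λ(emb c₊)·Ū(c)⋆ − λ(emb c₋)` at `Ū = Ū^k(U₀)`). [cite: Balaban1985BackgroundPropagators, (3.13)–(3.16) p.393; Balaban1985Variational, (44) p.285; Balaban1984PropagatorsI, (1.55) p.27] -/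
theorem QOfRecord_covDerivL2K [Fact (0 < c0Rec F K k)] (h : SmallBelow (avOfRecord F N K) k U₀)
    (l : SiteL2K ℂ (F.P K).d (fun _ => (F.P K).sitesPerDir 0) (c0Rec F K k) (WRec N)) :
    QOfRecord F N k U₀ (covDerivL2K ℂ (c0Rec F K k) (cRec F K k) (RRec F N U₀) l) =
      (WL2.equiv ℂ (wBRec F K k) (WRec N)).symm fun c : PBond (F.P K) k =>
        (phiRec N).symm ((cRec F K k * (((F.P K).L : ℂ) ^ k)⁻¹) •
          (((Averaging.iter (avOfRecord F N K) k U₀ c : SU N) : Matrix (Fin N) (Fin N) ℂ) * siteFieldIn F N k l (embIter k c.tgt) *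
              star ((Averaging.iter (avOfRecord F N K) k U₀ c : SU N) : Matrix (Fin N) (Fin N) ℂ) -
            siteFieldIn F N k l (embIter k c.src))) := by
  apply (WL2.equiv ℂ (wBRec F K k) (WRec N)).injective
  funext c
  rw [QOfRecord_apply, Equiv.apply_symm_apply, bondFieldIn_covDerivL2K]
  have hsm : (fun b : PBond (F.P K) 0 => cRec F K k • ((U₀ b : Matrix (Fin N) (Fin N) ℂ) * siteFieldIn F N k l b.tgt * star (U₀ b : Matrix (Fin N) (Fin N) ℂ) -
      siteFieldIn F N k l b.src)) =
      cRec F K k • fun b : PBond (F.P K) 0 => (U₀ b : Matrix (Fin N) (Fin N) ℂ) * siteFieldIn F N k l b.tgt * star (U₀ b : Matrix (Fin N) (Fin N) ℂ) -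
        siteFieldIn F N k l b.src := rfl
  rw [hsm, map_smul, Pi.smul_apply, qCplxOp_covGradM h (siteFieldIn F N k l) c, smul_smul]
  rfl

/-- ★★★ **(g2) AT EVERY GUARDED BACKGROUND**: if the gauge parameter vanishes at the `k`-block centres (`Q′♭ l = 0`, def-Y's ✓`QflatOfRecord`), then
`Q(U₀)(D(U₀) l) = 0` — infinitesimal RESIDUAL gauge variations of `U₀` are kernel directions of def-Y's pinned `Q(U₀)` (hypothesis (g2) of the (3.124) identities
`Q𝔊 = 0` at a general background; the tree had it at `1` and on the flat orbit only). [cite: Balaban1985Variational, p.284, (82)–(83) p.290, (102) p.293; Balaban1985BackgroundPropagators, (3.124) p.420] -/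
theorem QOfRecord_covDerivL2K_eq_zero_of_QflatOfRecord_eq_zero [Fact (0 < c0Rec F K k)] (h : SmallBelow (avOfRecord F N K) k U₀)
    (l : SiteL2K ℂ (F.P K).d (fun _ => (F.P K).sitesPerDir 0) (c0Rec F K k) (WRec N)) (hl : QflatOfRecord F N k l = 0) :
    QOfRecord F N k U₀ (covDerivL2K ℂ (c0Rec F K k) (cRec F K k) (RRec F N U₀) l) = 0 := by
  have hz := (QflatOfRecord_eq_zero_iff F N k l).1 hl
  rw [QOfRecord_covDerivL2K F k U₀ h l]
  apply (WL2.equiv ℂ (wBRec F K k) (WRec N)).injective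
  funext c
  rw [Equiv.apply_symm_apply, hz, hz, mul_zero, zero_mul, sub_self, smul_zero, map_zero]
  rfl

end Record

end Summit.QuantumFields.YangMills.Theorems.N07QOfRecordInfGauge
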